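import Mathlib
import HarnessLib

/-!
# DRAFT (not registered) — twist_split v4.4 candidate stub: the SOURCE-FREE local (TH)∩twisting statement in the full normal form
# item `LrcModEntire` (stmt-NavierStokesRegularity-20428), LEAD ns-poloidal-K2-p3 g9, 2026-08-28

`stub_localTHEmptySFRS` = v4.3's `stub_localTHEmptyHypNUGRS` with the free analytic pressure datum `A(t,z)` REPLACED by the explicit
source `A(t,z) := c₂·(∂ₜμ − ∂_z²μ)(t,z) − (c₂²/2)·∂_zμ(t,z)` for ONE real scalar `c₂` (= `v₂(p₀)` before the Galilean boost; μ = the REST-FRAME slope, hence the MINUS sign — K2-p2 g9's sign note 09:12Z: `galilean_E` prints `+` in the ORIGINAL slope at the sheared point, and ∂ₜμ_orig = ∂ₜμ′ − c₂∂_zμ′): on K-sparse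
class profiles the (TH) datum is source-free in the original frame (K2-p2 g8 `…SparseEnergySourceFreeDatum.exists_localTHDatum_sourceFree`,
conditional on sparse_energy S1 `stub_scaledEnergy`), the hyperbolic / non-umbilic relocations are sub-windows (A ≡ 0 persists), the boost to
the rest frame produces exactly this `A` (`…TwistingTHLocalGalilean.galilean_E` with `A = 0`, rewritten in the boosted slope), and rotation/scaling preserve the
form with `c₂ ↦ λc₂`.  v4.4 = {stub_scaledEnergy (shared with 19708 sparse_energy S1), stub_localTHEmptySFRS, stub_twistingThick}; the reduction
`stub_twistingTH_of_localEmptySF` (chain above, re-using the covariance computations of p585858/p586459/p607457/…Scaling) is the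
successor's file.  For the engines: every `a_j` letter becomes the polynomial `c₂·((j-th z-coefficient of μ_t) − (j+2)(j+1)m_{j+2}) +
…` — precisely a_j = c₂·(n_j − (j+2)(j+1)m_{j+2}) − (c₂²/2)(j+1)m_{j+1} in the REST-FRAME letters m (slope) and n (= [z^j]∂ₜμ′), ONE new scalar letter c₂ (weight 1); the rows (k,0,0) become laws.
WHAT THIS IS NOT: not registered, not a proof — a statement draft for K2-p2 / port-2 / cert lanes to agree the text.
-/

-- the summit and its single sub-problem share the name (CONVENTIONS §1)
set_option linter.dupNamespace false

namespace Summit.NavierStokesRegularity.NavierStokesRegularity.Theses.PoloidalWindowDoor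

open scoped RealInnerProductSpace InnerProductSpace Laplacian

/-- **DRAFT STUB (v4.4 candidate): the SOURCE-FREE local hyperbolic (TH)∩twisting system is empty at a non-umbilic rest point in the
rotation/scaling gauge.**  Text = `stub_localTHEmptyHypNUGRS` with `A` specialised to `c₂(∂ₜμ − ∂_z²μ) − (c₂²/2)∂_zμ` (rest-frame slope μ). [folklore] -/
theorem stub_localTHEmptySFRS :
    ∀ (u : ℝ → EuclideanSpace ℝ (Fin 3) → EuclideanSpace ℝ (Fin 3)) (μ : ℝ → ℝ → ℝ) (c₂ : ℝ)
      (U : Set (ℝ × EuclideanSpace ℝ (Fin 3))) (p₀ : ℝ × EuclideanSpace ℝ (Fin 3)),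
      IsOpen U → p₀ ∈ U →
      AnalyticOnNhd ℝ (Function.uncurry u) U →
      (∀ p ∈ U, AnalyticAt ℝ (Function.uncurry μ) (p.1, p.2 2)) →
      (∀ p ∈ U, fderiv ℝ (u p.1) p.2 (EuclideanSpace.single 0 1) 1 = fderiv ℝ (u p.1) p.2 (EuclideanSpace.single 1 1) 0) →
      (∀ p ∈ U, fderiv ℝ (u p.1) p.2 (EuclideanSpace.single 0 1) 0 + fderiv ℝ (u p.1) p.2 (EuclideanSpace.single 1 1) 1 +
        fderiv ℝ (u p.1) p.2 (EuclideanSpace.single 2 1) 2 = 0) →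
      (∀ p ∈ U, ∀ b : Fin 3, b ≠ 2 →
        fderiv ℝ (u p.1) p.2 (EuclideanSpace.single 2 1) b =
          μ p.1 (p.2 2) * fderiv ℝ (u p.1) p.2 (EuclideanSpace.single b 1) 2) →
      (∀ p ∈ U,
        (1 - μ p.1 (p.2 2)) *
            (deriv (fun s => u s p.2 2) p.1 + fderiv ℝ (fun y => u p.1 y 2) p.2 (u p.1 p.2)
              - Δ (fun y => u p.1 y 2) p.2) =
          (c₂ * (deriv (fun s => μ s (p.2 2)) p.1 - deriv (deriv (μ p.1)) (p.2 2)) -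
            c₂ ^ 2 / 2 * deriv (μ p.1) (p.2 2)) + (deriv (fun s => μ s (p.2 2)) p.1 - deriv (deriv (μ p.1)) (p.2 2)) * u p.1 p.2 2
            + deriv (μ p.1) (p.2 2) / 2 * u p.1 p.2 2 ^ 2
            - 2 * deriv (μ p.1) (p.2 2) * fderiv ℝ (u p.1) p.2 (EuclideanSpace.single 2 1) 2) →
      fderiv ℝ (fun y => fderiv ℝ (u p₀.1) y (EuclideanSpace.single 2 1) 2) p₀.2 (EuclideanSpace.single 0 1) *
            fderiv ℝ (u p₀.1) p₀.2 (EuclideanSpace.single 1 1) 2 -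
          fderiv ℝ (fun y => fderiv ℝ (u p₀.1) y (EuclideanSpace.single 2 1) 2) p₀.2 (EuclideanSpace.single 1 1) *
            fderiv ℝ (u p₀.1) p₀.2 (EuclideanSpace.single 0 1) 2 ≠ 0 →
      μ p₀.1 (p₀.2 2) ≠ 0 → μ p₀.1 (p₀.2 2) ≠ 1 → deriv (μ p₀.1) (p₀.2 2) ≠ 0 →
      μ p₀.1 (p₀.2 2) < 0 →
      (fderiv ℝ (u p₀.1) p₀.2 (EuclideanSpace.single 0 1) 0 ≠ fderiv ℝ (u p₀.1) p₀.2 (EuclideanSpace.single 1 1) 1 ∨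
        fderiv ℝ (u p₀.1) p₀.2 (EuclideanSpace.single 1 1) 0 ≠ 0) →
      u p₀.1 p₀.2 = 0 → 
      fderiv ℝ (u p₀.1) p₀.2 (EuclideanSpace.single 0 1) 2 = 0 →
      fderiv ℝ (u p₀.1) p₀.2 (EuclideanSpace.single 1 1) 2 = 1 → False := by
  sorry

end Summit.NavierStokesRegularity.NavierStokesRegularity.Theses.PoloidalWindowDoor
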